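import Summits.ResolutionOfSingularities.ResolutionOfSingularities.Theorems.FrobeniusLadderFInjectiveMacaulayficationX2CubicFormTStepRow
import HarnessLib

/-!
# T-side CLASS ROW, certificate adapters: how a bed discharges the «pointwise-smooth dehomogenisation» hypothesis — from ONE Nullstellensatz identity
# `1 = A·w + Σ_j B_j·∂_j w` (any CAS), or from one global derivation (Euler, the Fermat case)
# (crux `FInjectiveMacaulayfication` stmt-ResolutionOfSingularities-15315, chain w45a; usability layer for ✓ `X2CubicFormTStepRow.tStep_row_of_doublePoint_cubicForm` /
# `X2CubicFormFrontEnd.tStepInstanceAt_of_doublePoint_cubicForm`; seat res-L1-w45a-lead-1 g11)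

[OURS · L1 W4.5a] Support file (`--supports stmt-ResolutionOfSingularities-15315 --as helper`); def-free; UNCONDITIONAL; no named fact; NOT a statement of any manuscript. AI-written
(AI review is weaker than expert review).

* ★ `smooth_of_jacobian_certificate` — if `1 ∈ (w, ∂₀w, ∂₁w, ∂₂w)` (witnessed by explicit cofactors `A, B₀, B₁, B₂` with `A·w + Σ B_j·∂_j w = 1`), then for every prime `𝔮 ∋ w` some `∂_j w ∉ 𝔮`,
  hence the class hypothesis `∃ D, D w ∉ 𝔮` (take `D = ∂_j`). This is the certificate format a future bed supplies (one `ring` identity per chart cubic).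
* `smooth_of_jacobian_mem` — the same from the bare membership `1 ∈ Ideal.span {w, ∂₀w, ∂₁w, ∂₂w}`.
* `smooth_of_isUnit_derivation` — the Fermat/Euler case (= `X2YGBlowupRegularLocal.pointwise_of_isUnit`, re-exported in the class row's letter).
[cite: StacksProject, Tag 07PF (Jacobian criterion, context)] [folklore]
-/

-- single-problem summit: the doubled namespace component is forced
set_option linter.dupNamespace false

noncomputable section

namespace Summit.ResolutionOfSingularities.ResolutionOfSingularities.Theorems.FInjectiveMacaulayfication.X2CubicFormSmoothCert

open MvPolynomial
open Summit.ResolutionOfSingularities.ResolutionOfSingularities.Theorems.FInjectiveMacaulayfication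

variable (k : Type) [Field k]

/-- **From `1 ∈ (w, ∂₀w, ∂₁w, ∂₂w)` to pointwise smoothness**: at every prime `𝔮 ∋ w` some partial `∂_j w ∉ 𝔮` (else `1 ∈ 𝔮`), so `D = ∂_j` is a derivation with `D w ∉ 𝔮`.
[elementary; cite: StacksProject, Tag 07PF (context)] -/
theorem smooth_of_jacobian_mem (w : MvPolynomial (Fin 3) k)
    (hJ : (1 : MvPolynomial (Fin 3) k) ∈ Ideal.span ({w, pderiv 0 w, pderiv 1 w, pderiv 2 w} : Set (MvPolynomial (Fin 3) k))) :
    ∀ 𝔮 : Ideal (MvPolynomial (Fin 3) k), 𝔮.IsPrime → w ∈ 𝔮 → ∃ D : Derivation k (MvPolynomial (Fin 3) k) (MvPolynomial (Fin 3) k), D w ∉ 𝔮 := by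
  intro 𝔮 h𝔮 hw
  by_contra hall
  push Not at hall
  apply h𝔮.ne_top
  rw [Ideal.eq_top_iff_one]
  refine (Ideal.span_le.mpr ?_) hJ
  intro x hx
  simp only [Set.mem_insert_iff, Set.mem_singleton_iff] at hx
  rcases hx with rfl | rfl | rfl | rfl
  · exact hw
  · exact hall _
  · exact hall _
  · exact hall _

/-- ★ **THE JACOBIAN CERTIFICATE FORMAT**: explicit cofactors with `A·w + B₀·∂₀w + B₁·∂₁w + B₂·∂₂w = 1` give the class row's pointwise-smoothness hypothesis for the chart cubic `w`.
(For the Fermat cubic `w = 1 + ΣYᵢ³`, `3 ≠ 0`: `A = 1`, `B_i = −Y_i/3`.) [elementary] -/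
theorem smooth_of_jacobian_certificate (w A B₀ B₁ B₂ : MvPolynomial (Fin 3) k) (hcert : A * w + B₀ * pderiv 0 w + B₁ * pderiv 1 w + B₂ * pderiv 2 w = 1) :
    ∀ 𝔮 : Ideal (MvPolynomial (Fin 3) k), 𝔮.IsPrime → w ∈ 𝔮 → ∃ D : Derivation k (MvPolynomial (Fin 3) k) (MvPolynomial (Fin 3) k), D w ∉ 𝔮 := by
  refine smooth_of_jacobian_mem k w ?_
  rw [← hcert]
  have hm : ∀ x ∈ ({w, pderiv 0 w, pderiv 1 w, pderiv 2 w} : Set (MvPolynomial (Fin 3) k)), x ∈ Ideal.span ({w, pderiv 0 w, pderiv 1 w, pderiv 2 w} : Set _) :=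
    fun x hx => Ideal.subset_span hx
  refine Ideal.add_mem _ (Ideal.add_mem _ (Ideal.add_mem _ (Ideal.mul_mem_left _ _ (hm _ (by simp))) (Ideal.mul_mem_left _ _ (hm _ (by simp))))
    (Ideal.mul_mem_left _ _ (hm _ (by simp)))) (Ideal.mul_mem_left _ _ (hm _ (by simp)))

/-- **The one-derivation case** (Fermat/Euler): a derivation `D₀` with `D₀ w` a unit modulo `w` gives the pointwise hypothesis (`X2YGBlowupRegularLocal.pointwise_of_isUnit`). [plumbing] -/
theorem smooth_of_isUnit_derivation (w : MvPolynomial (Fin 3) k) (D₀ : Derivation k (MvPolynomial (Fin 3) k) (MvPolynomial (Fin 3) k))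
    (hD₀ : IsUnit (Ideal.Quotient.mk (Ideal.span {w}) (D₀ w))) :
    ∀ 𝔮 : Ideal (MvPolynomial (Fin 3) k), 𝔮.IsPrime → w ∈ 𝔮 → ∃ D : Derivation k (MvPolynomial (Fin 3) k) (MvPolynomial (Fin 3) k), D w ∉ 𝔮 :=
  X2YGBlowupRegularLocal.pointwise_of_isUnit w D₀ hD₀

/-- **Worked example of the format: the Fermat chart cubic** `w = 1 + Y₀³ + Y₁³ + Y₂³`, `3 ≠ 0`: `1·w − Σ (Yᵢ/3)·∂ᵢw = 1`. [elementary] -/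
theorem fermat_jacobian_certificate (h3 : (3 : k) ≠ 0) :
    (1 : MvPolynomial (Fin 3) k) * (1 + X 0 ^ 3 + X 1 ^ 3 + X 2 ^ 3) +
      (-(C (3 : k)⁻¹) * X 0) * pderiv 0 (1 + X 0 ^ 3 + X 1 ^ 3 + X 2 ^ 3 : MvPolynomial (Fin 3) k) +
      (-(C (3 : k)⁻¹) * X 1) * pderiv 1 (1 + X 0 ^ 3 + X 1 ^ 3 + X 2 ^ 3 : MvPolynomial (Fin 3) k) +
      (-(C (3 : k)⁻¹) * X 2) * pderiv 2 (1 + X 0 ^ 3 + X 1 ^ 3 + X 2 ^ 3 : MvPolynomial (Fin 3) k) = 1 := by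
  have hd : ∀ (b c d : Fin 3), b ≠ c → b ≠ d →
      pderiv b (1 + X b ^ 3 + X c ^ 3 + X d ^ 3 : MvPolynomial (Fin 3) k) = 3 * X b ^ 2 := by
    intro b c d hbc hbd
    simp only [map_add, Derivation.map_one_eq_zero, Derivation.leibniz_pow, pderiv_X_self, pderiv_X_of_ne hbc.symm, pderiv_X_of_ne hbd.symm,
      zero_add, smul_eq_mul, mul_one, nsmul_eq_mul]
    push_cast
    ring
  have h0 : pderiv 0 (1 + X 0 ^ 3 + X 1 ^ 3 + X 2 ^ 3 : MvPolynomial (Fin 3) k) = 3 * X 0 ^ 2 := hd 0 1 2 (by decide) (by decide)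
  have h1 : pderiv 1 (1 + X 0 ^ 3 + X 1 ^ 3 + X 2 ^ 3 : MvPolynomial (Fin 3) k) = 3 * X 1 ^ 2 := by
    have := hd 1 0 2 (by decide) (by decide); rw [show (1 + X 1 ^ 3 + X 0 ^ 3 + X 2 ^ 3 : MvPolynomial (Fin 3) k) = 1 + X 0 ^ 3 + X 1 ^ 3 + X 2 ^ 3 by ring] at this; exact this
  have h2 : pderiv 2 (1 + X 0 ^ 3 + X 1 ^ 3 + X 2 ^ 3 : MvPolynomial (Fin 3) k) = 3 * X 2 ^ 2 := by
    have := hd 2 0 1 (by decide) (by decide); rw [show (1 + X 2 ^ 3 + X 0 ^ 3 + X 1 ^ 3 : MvPolynomial (Fin 3) k) = 1 + X 0 ^ 3 + X 1 ^ 3 + X 2 ^ 3 by ring] at this; exact this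
  rw [h0, h1, h2]
  have h3C : (C (3 : k)⁻¹ : MvPolynomial (Fin 3) k) * 3 = 1 := by
    rw [← map_ofNat C 3, ← map_mul, inv_mul_cancel₀ h3, map_one]
  linear_combination (-(X 0 ^ 3) - X 1 ^ 3 - X 2 ^ 3) * h3C

end Summit.ResolutionOfSingularities.ResolutionOfSingularities.Theorems.FInjectiveMacaulayfication.X2CubicFormSmoothCert

end
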